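import Summits.AtomisticToContinuum.HydrodynamicLimit.Theses.JParityClosure
import Summits.AtomisticToContinuum.HydrodynamicLimit.Theorems.JParityClosureParityRigidityMollify
import Summits.AtomisticToContinuum.HydrodynamicLimit.Theorems.JParityClosureParityBandClosureDetailedBalanceOfSymmetricRecord
import Mathlib.MeasureTheory.Measure.HasOuterApproxClosed
import Mathlib.MeasureTheory.Integral.BoundedContinuousFunction
import Mathlib.Logic.Equiv.Finset
import Mathlib.Data.Rat.Denumerable
import HarnessLib

/-!
# Countable test families and bandwidths (helper A for the stub `stub_countableTestUpgrade`)

Helper file for the stub `stub_countableTestUpgrade` of the line `transfer-weighted-parity-chain`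
(skeleton v3) of the crux `JParityClosure.ParityBandClosure` (stmt-AtomisticToContinuum-17608):
the COUNTABLE DATA of the waypoint `CountableTestUpgrade` and their analytic properties.

WHAT.
* §A. On a second-countable topological space `X` with `HasOuterApproxClosed X` (e.g. any
  pseudo-metrizable space) there is a sequence `t : ℕ → (X →ᵇ ℝ≥0)` of `[0,1]`-valued bounded
  continuous functions which DETERMINES finite Borel measures in the strong monotone form
  (`exists_testSeq`): if `∫ t m dμ ≤ ∫ t m dμ'` for all `m` (finite `μ, μ'`), then `μ F ≤ μ' F`
  for every closed `F`. Consequences for such a family: equality of the countably many integrals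
  forces `μ = μ'` (`ext_of_integral_family`), and `c ∫ t m dμ ≤ ∫ t m dμ'` gives `c μ F ≤ μ' F` on
  closed sets (`smul_measure_isClosed_le_of_family`).
* §B. On the collision-record space `Q = (V3 × V3) × S²` (conventions VERBATIM those of
  `ParityRigidity` / the skeleton: KDE `h_ϑ(v) = ∫ localMaxwellian 1 ϑ² v v' dν`, surprisal jump
  `F_ϑ(q) = log h(v) + log h(w) − log h(v′) − log h(w′)`, `(v′, w′) = collide ω (v, w)`):
  measurability of the Metropolis weight `min(1, e^{−F})` (`measurable_weight`), continuity of the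
  KDE in `ϑ ≠ 0` (`continuousOn_kde`), continuity of `ϑ ↦ ∫ Ψ min(1, e^{−F_ϑ}) dκ` on `ϑ ≠ 0`
  (`continuousOn_oddIntegral`), a dense bandwidth sequence in `(0,1)` (`stub_countableTestUpgradeA`,
  the rationals of `(0,1)`) and the density upgrade `eq_zero_of_mem_closure`.

PROOF SKETCH. §A: enumerate a countable base `b` (with `∅`); the closed test sets are
`⋂ n ∈ S, (b n)ᶜ`, `S : Finset ℕ`, and `t (S, l)` is Mathlib's `IsClosed.apprSeq` (outer
approximation of the indicator of a closed set) at stage `l`. Bounded convergence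
(`HasOuterApproxClosed.tendsto_lintegral_apprSeq`) passes the inequality to the closed test sets;
every closed `F` is the decreasing intersection of the test sets with
`S_i = {n ≤ i | b n ⊆ Fᶜ}`, so continuity from above (`tendsto_measure_iInter_atTop`) passes it to
`F`; closed sets form a π-system generating the Borel σ-algebra (`ext_of_generate_finite`).
§B: dominated convergence (`continuousOn_of_dominated`) twice — the Gaussian kernel is bounded by
`1` and continuous in `ϑ ≠ 0` (after `integral_localMaxwellian_eq`), a positive KDE has a
continuous logarithm, and the weighted integrand is bounded by `sup |Ψ|`; density of `ℚ ∩ (0,1)`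
(`exists_rat_btwn`) and uniqueness of limits along `𝓝[range ϑ₀] ϑ`.

REFERENCES. P. Billingsley, *Convergence of Probability Measures*, 2nd ed. 1999, Thm 1.2 and
§2 (a finite Borel measure on a metric space is determined by its values on closed sets, closed
sets are approximated from outside by bounded continuous functions; separability gives countable
determining classes); Mathlib `MeasureTheory/Measure/HasOuterApproxClosed`.
-/

noncomputable section

namespace Summit.AtomisticToContinuum.HydrodynamicLimit.Theorems.ParityBandClosureCountableUpgrade

open scoped BigOperators Topology Classical MeasureTheory ENNReal NNReal InnerProductSpace
open scoped BoundedContinuousFunction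
open Filter Set MeasureTheory TopologicalSpace
open Literature.MathematicalPhysics.KineticTheory Literature.Analysis.FluidPDE

/-! ## §A A countable measure-determining family of bounded continuous test functions -/

section Determining

variable {X : Type*} [TopologicalSpace X] [MeasurableSpace X] [OpensMeasurableSpace X]

/-- Step 1 (one closed set): if the integrals of the outer approximations `hF.apprSeq l` of the
indicator of a closed set `F` against a finite measure `μ` are dominated by those against a finite
measure `μ'`, then `μ F ≤ μ' F` (bounded convergence along `IsClosed.apprSeq`). [folklore] -/
theorem measure_le_of_lintegral_apprSeq_le [HasOuterApproxClosed X] {F : Set X} (hF : IsClosed F)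
    {μ μ' : Measure X} [IsFiniteMeasure μ] [IsFiniteMeasure μ']
    (h : ∀ l, ∫⁻ x, hF.apprSeq l x ∂μ ≤ ∫⁻ x, hF.apprSeq l x ∂μ') : μ F ≤ μ' F :=
  le_of_tendsto_of_tendsto' (HasOuterApproxClosed.tendsto_lintegral_apprSeq hF μ)
    (HasOuterApproxClosed.tendsto_lintegral_apprSeq hF μ') h

/-- Step 2 (all closed sets): let `b : ℕ → Set X` be a sequence of open sets forming a base of the
topology. If `μ ≤ μ'` on every closed test set `⋂ n ∈ S, (b n)ᶜ`, `S : Finset ℕ` (finite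
measures), then `μ F ≤ μ' F` for every closed `F` — every closed set is the decreasing
intersection of the test sets with `S_i = {n ≤ i | b n ⊆ Fᶜ}`, and finite measures are continuous
from above. [folklore] -/
theorem measure_isClosed_le_of_base {b : ℕ → Set X} (hbo : ∀ n, IsOpen (b n))
    (hb : ∀ U : Set X, IsOpen U → ∀ x ∈ U, ∃ n, x ∈ b n ∧ b n ⊆ U)
    {μ μ' : Measure X} [IsFiniteMeasure μ] [IsFiniteMeasure μ']
    (h : ∀ S : Finset ℕ, μ (⋂ n ∈ S, (b n)ᶜ) ≤ μ' (⋂ n ∈ S, (b n)ᶜ)) {F : Set X}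
    (hF : IsClosed F) : μ F ≤ μ' F := by
  have hcl : ∀ S : Finset ℕ, IsClosed (⋂ n ∈ S, (b n)ᶜ) := fun S =>
    isClosed_biInter fun n _ => (hbo n).isClosed_compl
  -- the partial index sets: basic open sets among the first `i + 1` lying inside `Fᶜ`
  set S : ℕ → Finset ℕ := fun i => (Finset.range (i + 1)).filter fun n => b n ⊆ Fᶜ with hS
  have hmem : ∀ i n, n ∈ S i ↔ n < i + 1 ∧ b n ⊆ Fᶜ := fun i n => by
    simp only [hS, Finset.mem_filter, Finset.mem_range]
  have hanti : Antitone fun i => ⋂ n ∈ S i, (b n)ᶜ := by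
    intro i j hij x hx
    simp only [mem_iInter, mem_compl_iff] at hx ⊢
    intro n hn
    obtain ⟨hn1, hn2⟩ := (hmem i n).1 hn
    exact hx n ((hmem j n).2 ⟨by omega, hn2⟩)
  have hFeq : (⋂ i, ⋂ n ∈ S i, (b n)ᶜ) = F := by
    apply Subset.antisymm
    · intro x hx
      by_contra hxF
      obtain ⟨n, hxn, hnF⟩ := hb Fᶜ hF.isOpen_compl x (mem_compl hxF)
      have hx' : x ∈ ⋂ k ∈ S n, (b k)ᶜ := mem_iInter.1 hx n
      have hnS : n ∈ S n := (hmem n n).2 ⟨Nat.lt_succ_self n, hnF⟩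
      exact (mem_iInter₂.1 hx' n hnS) hxn
    · intro x hxF
      refine mem_iInter.2 fun i => mem_iInter₂.2 fun n hn => ?_
      exact fun hxn => ((hmem i n).1 hn).2 hxn hxF
  have h1 := tendsto_measure_iInter_atTop (μ := μ)
    (fun i => (hcl (S i)).measurableSet.nullMeasurableSet) hanti ⟨0, measure_ne_top μ _⟩
  have h2 := tendsto_measure_iInter_atTop (μ := μ')
    (fun i => (hcl (S i)).measurableSet.nullMeasurableSet) hanti ⟨0, measure_ne_top μ' _⟩
  rw [hFeq] at h1 h2
  exact le_of_tendsto_of_tendsto' h1 h2 fun i => h (S i)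

variable (X) in
/-- **A countable determining family of test functions.** On a second-countable space with
`HasOuterApproxClosed` (e.g. a pseudo-metrizable space) there is a sequence `t m` of bounded
continuous `[0,1]`-valued functions such that, for all finite measures `μ, μ'`,
`(∀ m, ∫ t m dμ ≤ ∫ t m dμ') → μ F ≤ μ' F` for every closed `F`.  Construction: `t (S, l)` is the
`l`-th outer approximation `IsClosed.apprSeq` of the indicator of `⋂ n ∈ S, (b n)ᶜ` for an
enumeration `b` of a countable base (with `∅`), `S : Finset ℕ`; Steps 1–2 above. [folklore] -/
theorem exists_testSeq [SecondCountableTopology X] [HasOuterApproxClosed X] :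
    ∃ t : ℕ → (X →ᵇ ℝ≥0), (∀ m x, t m x ≤ 1) ∧
      ∀ (μ μ' : Measure X) [IsFiniteMeasure μ] [IsFiniteMeasure μ'],
        (∀ m, ∫ x, (t m x : ℝ) ∂μ ≤ ∫ x, (t m x : ℝ) ∂μ') → ∀ F : Set X, IsClosed F → μ F ≤ μ' F := by
  -- an enumeration of a countable base together with `∅`
  obtain ⟨b, hb⟩ : ∃ b : ℕ → Set X, insert ∅ (countableBasis X) = range b :=
    ((countable_countableBasis X).insert ∅).exists_eq_range (insert_nonempty ∅ _)
  have hbo : ∀ n, IsOpen (b n) := by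
    intro n
    have hn : b n ∈ insert ∅ (countableBasis X) := by
      rw [hb]
      exact mem_range_self n
    rcases mem_insert_iff.1 hn with hn | hn
    · rw [hn]
      exact isOpen_empty
    · exact isOpen_of_mem_countableBasis hn
  have hbU : ∀ U : Set X, IsOpen U → ∀ x ∈ U, ∃ n, x ∈ b n ∧ b n ⊆ U := by
    intro U hU x hx
    obtain ⟨v, hv, hxv, hvU⟩ := (isBasis_countableBasis X).exists_subset_of_mem_open hx hU
    have h : v ∈ range b := by
      rw [← hb]
      exact mem_insert_of_mem _ hv
    obtain ⟨n, rfl⟩ := h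
    exact ⟨n, hxv, hvU⟩
  have hcl : ∀ S : Finset ℕ, IsClosed (⋂ n ∈ S, (b n)ᶜ) := fun S =>
    isClosed_biInter fun n _ => (hbo n).isClosed_compl
  refine ⟨fun m => (hcl ((Denumerable.eqv (Finset ℕ × ℕ)).symm m).1).apprSeq
      ((Denumerable.eqv (Finset ℕ × ℕ)).symm m).2,
    fun m x => HasOuterApproxClosed.apprSeq_apply_le_one _ _ _, ?_⟩
  intro μ μ' _ _ h F hF
  refine measure_isClosed_le_of_base hbo hbU (fun S => ?_) hF
  refine measure_le_of_lintegral_apprSeq_le (hcl S) fun l => ?_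
  have := h (Denumerable.eqv (Finset ℕ × ℕ) (S, l))
  simp only [Equiv.symm_apply_apply] at this
  rw [← ((hcl S).apprSeq l).toReal_lintegral_coe_eq_integral μ,
    ← ((hcl S).apprSeq l).toReal_lintegral_coe_eq_integral μ',
    ENNReal.toReal_le_toReal (((hcl S).apprSeq l).lintegral_lt_top_of_nnreal μ).ne
      (((hcl S).apprSeq l).lintegral_lt_top_of_nnreal μ').ne] at this
  exact this

omit [OpensMeasurableSpace X] in
/-- Scaled form: for a determining family `t` as in `exists_testSeq`, if
`c * ∫ t m dμ ≤ ∫ t m dμ'` for all `m` with `c ≥ 0` (finite measures), then `ofReal c * μ F ≤ μ' F`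
for every closed `F`. [folklore] -/
theorem smul_measure_isClosed_le_of_family {t : ℕ → (X →ᵇ ℝ≥0)}
    (ht : ∀ (μ μ' : Measure X) [IsFiniteMeasure μ] [IsFiniteMeasure μ'],
      (∀ m, ∫ x, (t m x : ℝ) ∂μ ≤ ∫ x, (t m x : ℝ) ∂μ') → ∀ F : Set X, IsClosed F → μ F ≤ μ' F)
    {μ μ' : Measure X} [IsFiniteMeasure μ] [IsFiniteMeasure μ'] {c : ℝ} (hc : 0 ≤ c)
    (h : ∀ m, c * ∫ x, (t m x : ℝ) ∂μ ≤ ∫ x, (t m x : ℝ) ∂μ') {F : Set X} (hF : IsClosed F) :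
    ENNReal.ofReal c * μ F ≤ μ' F := by
  have key := ht (c.toNNReal • μ) μ' (fun m => ?_) F hF
  · rwa [Measure.coe_nnreal_smul_apply] at key
  · rw [integral_smul_nnreal_measure, NNReal.smul_def, smul_eq_mul, Real.coe_toNNReal c hc]
    exact h m

end Determining

section Ext

variable {X : Type*} [TopologicalSpace X] [MeasurableSpace X] [BorelSpace X]

/-- **The family determines finite Borel measures.** For a determining family `t` as in
`exists_testSeq`, two finite Borel measures with the same integrals of all `t m` coincide (they
agree on the π-system of closed sets, which generates the Borel σ-algebra). [folklore] -/
theorem ext_of_integral_family {t : ℕ → (X →ᵇ ℝ≥0)}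
    (ht : ∀ (μ μ' : Measure X) [IsFiniteMeasure μ] [IsFiniteMeasure μ'],
      (∀ m, ∫ x, (t m x : ℝ) ∂μ ≤ ∫ x, (t m x : ℝ) ∂μ') → ∀ F : Set X, IsClosed F → μ F ≤ μ' F)
    {μ μ' : Measure X} [IsFiniteMeasure μ] [IsFiniteMeasure μ']
    (h : ∀ m, ∫ x, (t m x : ℝ) ∂μ = ∫ x, (t m x : ℝ) ∂μ') : μ = μ' := by
  have key : ∀ F : Set X, IsClosed F → μ F = μ' F := fun F hF =>
    le_antisymm (ht μ μ' (fun m => (h m).le) F hF) (ht μ' μ (fun m => (h m).ge) F hF)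
  apply ext_of_generate_finite _ ?_ isPiSystem_isClosed
  · exact fun F hF => key F hF
  · exact key univ isClosed_univ
  · rw [BorelSpace.measurable_eq (α := X), borel_eq_generateFrom_isClosed]

end Ext

/-! ## §B The collision-record space: Metropolis weight, KDE continuity, bandwidths -/

/-- The post-collisional pair `q ↦ collide q.2 q.1` is continuous on `Q = (V3 × V3) × S²`.
[folklore] -/
theorem continuous_collidePair :
    Continuous fun q : (V3 × V3) × Metric.sphere (0 : V3) 1 => collide q.2 q.1 := by
  unfold collide
  fun_prop

/-- The Metropolis weight `min(1, e^{−F})`, `F(q) = log h(v) + log h(w) − log h(v′) − log h(w′)`, is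
measurable on `Q` for a measurable `h`. [folklore] -/
theorem measurable_weight {h : V3 → ℝ} (hh : Measurable h) :
    Measurable fun q : (V3 × V3) × Metric.sphere (0 : V3) 1 =>
      min 1 (Real.exp (-(Real.log (h q.1.1) + Real.log (h q.1.2) -
        Real.log (h (collide q.2 q.1).1) - Real.log (h (collide q.2 q.1).2)))) := by
  have hc := continuous_collidePair.measurable
  exact measurable_const.min ((((hh.comp (measurable_fst.comp measurable_fst)).log.add
    (hh.comp (measurable_snd.comp measurable_fst)).log).sub
    (hh.comp (measurable_fst.comp hc)).log).sub (hh.comp (measurable_snd.comp hc)).log).neg.exp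

/-- The Gaussian KDE `ϑ ↦ h^ν_ϑ(v) = ∫ localMaxwellian 1 ϑ² v v' dν(v')` of a probability law `ν`
is continuous on `ϑ ≠ 0` (dominated convergence: after `integral_localMaxwellian_eq` the Gaussian
kernel is bounded by `1` and continuous in `ϑ ≠ 0`, and the normalisation `(2πϑ²)^{-d/2}` is
continuous there). [folklore] -/
theorem continuousOn_kde (ν : Measure V3) [IsProbabilityMeasure ν] (v : V3) :
    ContinuousOn (fun ϑ : ℝ => ∫ v', localMaxwellian 1 (ϑ ^ 2) v v' ∂ν) {ϑ | ϑ ≠ 0} := by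
  have h1 : ContinuousOn (fun ϑ : ℝ => ∫ v', Real.exp (-‖v - v'‖ ^ 2 / (2 * ϑ ^ 2)) ∂ν)
      {ϑ | ϑ ≠ 0} := by
    refine continuousOn_of_dominated (bound := fun _ => (1 : ℝ)) (fun ϑ _ => ?_)
      (fun ϑ _ => ae_of_all _ fun v' => ?_) (integrable_const 1) (ae_of_all _ fun v' => ?_)
    · exact Continuous.aestronglyMeasurable (by fun_prop)
    · rw [Real.norm_eq_abs, abs_of_pos (Real.exp_pos _), Real.exp_le_one_iff, neg_div, neg_nonpos]
      positivity
    · refine (continuousOn_const.div (by fun_prop) fun ϑ hϑ => ?_).rexp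
      exact mul_ne_zero two_ne_zero (pow_ne_zero 2 hϑ)
  have h2 : ContinuousOn (fun ϑ : ℝ => (2 * Real.pi * ϑ ^ 2) ^ (-(Module.finrank ℝ V3 : ℝ) / 2))
      {ϑ | ϑ ≠ 0} :=
    ContinuousOn.rpow_const (by fun_prop) fun ϑ hϑ =>
      Or.inl (mul_ne_zero (mul_ne_zero two_ne_zero Real.pi_pos.ne') (pow_ne_zero 2 hϑ))
  refine (h2.mul h1).congr fun ϑ _ => ?_
  exact ParityRigidity.integral_localMaxwellian_eq ν ϑ v

/-- **Continuity in the bandwidth.** For a kernel estimate `h ϑ v`, measurable in `v`, continuous in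
`ϑ ≠ 0` and positive there, a finite record `κ` and a bounded continuous `Ψ`, the Metropolis-odd
test functional `ϑ ↦ ∫ Ψ min(1, e^{−F_ϑ}) dκ`, `F_ϑ(q) = log h_ϑ(v) + log h_ϑ(w) − log h_ϑ(v′) −
log h_ϑ(w′)`, is continuous on `ϑ ≠ 0` (dominated convergence, bound `sup |Ψ|`). [folklore] -/
theorem continuousOn_oddIntegral {h : ℝ → V3 → ℝ} (hm : ∀ ϑ, Measurable (h ϑ))
    (hc : ∀ v, ContinuousOn (fun ϑ => h ϑ v) {ϑ | ϑ ≠ 0}) (hpos : ∀ ϑ, ϑ ≠ 0 → ∀ v, 0 < h ϑ v)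
    (κ : Measure ((V3 × V3) × Metric.sphere (0 : V3) 1)) [IsFiniteMeasure κ]
    {Ψ : (V3 × V3) × Metric.sphere (0 : V3) 1 → ℝ} (hΨc : Continuous Ψ) {C : ℝ}
    (hΨb : ∀ q, |Ψ q| ≤ C) :
    ContinuousOn (fun ϑ => ∫ q, Ψ q * min 1 (Real.exp (-(Real.log (h ϑ q.1.1) +
      Real.log (h ϑ q.1.2) - Real.log (h ϑ (collide q.2 q.1).1) -
      Real.log (h ϑ (collide q.2 q.1).2)))) ∂κ) {ϑ | ϑ ≠ 0} := by
  have hk : ∀ v, ContinuousOn (fun ϑ => Real.log (h ϑ v)) {ϑ | ϑ ≠ 0} := fun v =>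
    (hc v).log fun ϑ hϑ => (hpos ϑ hϑ v).ne'
  have hF : ∀ q : (V3 × V3) × Metric.sphere (0 : V3) 1, ContinuousOn (fun ϑ =>
      Real.log (h ϑ q.1.1) + Real.log (h ϑ q.1.2) - Real.log (h ϑ (collide q.2 q.1).1) -
        Real.log (h ϑ (collide q.2 q.1).2)) {ϑ | ϑ ≠ 0} := fun q =>
    (((hk _).add (hk _)).sub (hk _)).sub (hk _)
  refine continuousOn_of_dominated (bound := fun _ => C) (fun ϑ _ => ?_)
    (fun ϑ _ => ae_of_all _ fun q => ?_) (integrable_const C) (ae_of_all _ fun q => ?_)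
  · exact (hΨc.measurable.mul (measurable_weight (hm ϑ))).aestronglyMeasurable
  · rw [norm_mul, Real.norm_eq_abs, Real.norm_eq_abs,
      abs_of_pos (ParityBandClosureDetailedBalance.min_one_exp_neg_pos _)]
    calc |Ψ q| * min 1 (Real.exp (-(Real.log (h ϑ q.1.1) + Real.log (h ϑ q.1.2) -
          Real.log (h ϑ (collide q.2 q.1).1) - Real.log (h ϑ (collide q.2 q.1).2))))
        ≤ |Ψ q| * 1 := by
          gcongr
          exact min_le_left _ _
      _ ≤ C := by rw [mul_one]; exact hΨb q
  · have hmw : Continuous fun x : ℝ => min 1 (Real.exp (-x)) := by fun_prop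
    exact continuousOn_const.mul (hmw.comp_continuousOn (hF q))

/-- **The bandwidth sequence** (registered helper stub `stub_countableTestUpgradeA` of the stub
`stub_countableTestUpgrade`). There is a sequence `ϑ₀ k ∈ (0, 1)` whose range is dense in `(0, 1)`
(the rationals of `(0, 1)`, coded through `ℚ ≃ ℕ`). [folklore] -/
theorem stub_countableTestUpgradeA : ∃ ϑ₀ : ℕ → ℝ, (∀ k, 0 < ϑ₀ k ∧ ϑ₀ k < 1) ∧ ∀ ϑ : ℝ, 0 < ϑ → ϑ < 1 → ϑ ∈ closure (Set.range ϑ₀) := by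
  refine ⟨fun k => if 0 < (((Denumerable.eqv ℚ).symm k : ℚ) : ℝ) ∧
      (((Denumerable.eqv ℚ).symm k : ℚ) : ℝ) < 1 then (((Denumerable.eqv ℚ).symm k : ℚ) : ℝ)
      else 1 / 2, fun k => ?_, fun ϑ h0 h1 => ?_⟩
  · dsimp only
    split_ifs with h
    · exact h
    · norm_num
  · rw [Metric.mem_closure_iff]
    intro ε hε
    obtain ⟨r, hr1, hr2⟩ := exists_rat_btwn (max_lt h0 (sub_lt_self ϑ hε) : max 0 (ϑ - ε) < ϑ)
    have hr0 : (0 : ℝ) < r := (le_max_left _ _).trans_lt hr1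
    refine ⟨r, ⟨Denumerable.eqv ℚ r, ?_⟩, ?_⟩
    · simp only [Equiv.symm_apply_apply, hr0, hr2.trans h1, and_self, if_true]
    · rw [Real.dist_eq, abs_of_pos (sub_pos.2 hr2)]
      linarith [le_max_right 0 (ϑ - ε)]

/-- **Density upgrade.** A function continuous on `ϑ ≠ 0` that vanishes on a sequence of nonzero
bandwidths vanishes at every nonzero point of the closure of the sequence. [folklore] -/
theorem eq_zero_of_mem_closure {ϑ₀ : ℕ → ℝ} (hϑ₀ : ∀ k, ϑ₀ k ≠ 0) {Λ : ℝ → ℝ}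
    (hΛ : ContinuousOn Λ {ϑ | ϑ ≠ 0}) (h : ∀ k, Λ (ϑ₀ k) = 0) {ϑ : ℝ} (h0 : ϑ ≠ 0)
    (hcl : ϑ ∈ closure (Set.range ϑ₀)) : Λ ϑ = 0 := by
  have hsub : Set.range ϑ₀ ⊆ {ϑ | ϑ ≠ 0} := by
    rintro _ ⟨k, rfl⟩
    exact hϑ₀ k
  have hcont : ContinuousWithinAt Λ (Set.range ϑ₀) ϑ := (hΛ ϑ h0).mono hsub
  haveI : (𝓝[Set.range ϑ₀] ϑ).NeBot := mem_closure_iff_nhdsWithin_neBot.1 hcl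
  have hev : Λ =ᶠ[𝓝[Set.range ϑ₀] ϑ] fun _ => 0 := by
    filter_upwards [self_mem_nhdsWithin] with x hx
    obtain ⟨k, rfl⟩ := hx
    exact h k
  exact (tendsto_const_nhds_iff.1 (hcont.tendsto.congr' hev)).symm

end Summit.AtomisticToContinuum.HydrodynamicLimit.Theorems.ParityBandClosureCountableUpgrade

end
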